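import Summits.QuantumFields.BalabanUV.T4Continuum.Support.NE7CubeGradientOfLandauSup
import Summits.QuantumFields.BalabanUV.T4Continuum.Support.NE7GradientCurrencyLandauEL
import Summits.QuantumFields.BalabanUV.T4Continuum.Support.NE3EnergyShapes
import HarnessLib

/-!
# NE7 — THE GRADIENT LETTER OF THE CUBE CHART WITH THE LANDAU REACTION IN EULER–LAGRANGE FORM (F303): F299∕F300 re-run with the reaction read on
# `S = sinh A = (e^{A} − e^{−A})∕2` — the form the lattice Landau condition of a TRACE-LINK MINIMISING gauge delivers ((161b): `div S = 0`) — the difference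
# `∇div A − ∇div S = O((e^ρ − 1)·∇A)` joining the a priori term of the distance-weighted bootstrap

Cell `pub-balaban`, rung (B)+1 sub-cell t4, lineage `b2b-balaban-t4-ne7-p1` (CRUX PROVER NE7 #1 = OWNER of row NE7), generation 92; memo
`t4/b2b-balaban-t4-ne7-p1-g92/LOG-OBSTRUCTION.md` §4 (ROAD (U), brick (B1) in the form the cube Landau MINIMISER will feed).  Over F299 `NE7LocalGradientBootstrap`
(`weighted_bootstrap`, `norm_fdiff_le_of_plaqDiv_local`), F300 `NE7CubeGradientOfLandauSup` (`norm_plaqDivFlat_le_covDiv_local`), lineage #2's (158b)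
`NE7GradientCurrencyLandauEL.norm_sinhRem_sub_sinhRem_le`.

WHY.  F300∕F302 take the Landau reaction as a bound `r` on `∇div A` (the log chart); an exact `div A = 0` gauge would give `r = 0`, but the gauge one CONSTRUCTS on a cube by
minimising the smooth trace-link functional `Σ_{b⊂Q}(1 − Re tr U^{g}_b)` over the site gauges of the cube satisfies instead `div_Q S = 0`, `S = (W − W†)∕2 = sinh A` for
`W = e^{A}` ((161b) `NE7LatticeLandauEuler.landau_of_isMin` on the torus; the cube twin is the next file).  `sinh A − A` is `(e^ρ − 1)`-Lipschitz on `‖·‖ ≤ ρ`, so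
`‖∇div A − ∇div S‖ ≤ 2(d+1)(e^ρ − 1)·G` with `G` the local a priori gradient — a term of exactly the kind F299's weighted bootstrap absorbs (θ grows by `4(d+1)(e^ρ − 1)`;
the absorption condition becomes `32(d+1)R₀(e^{4ρ}−1) + 16(d+1)R₀(e^ρ−1) ≤ 1`, still `≍ ℓ²t ≪ 1` at `R₀ ≍ ℓM`, `ρ ≍ ℓt∕M`).  Output: the cube chart's gradient letter from
the SUP letter + the current + the EL reaction — for the minimiser the EL reaction is ZERO, so the chart input of route 1 becomes the sup letter of a cube trace-link
minimiser ALONE (the target of ROAD (U) (B2)).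
WHAT ([folklore]; 0 def, 0 sorry).  §1 `norm_sub_le_norm_add_of_sub`, `norm_dDiv_sub_dDiv_sinh_le_local` ((158b) §1 localised).  §2 `norm_fdiff_le_of_plaqDiv_local_EL`,
**`norm_fdiff_le_of_plaqDiv_cube_EL`** (F299 §3∕§4 with the EL reaction).  §3 **`norm_fdiff_le_of_landauEL_cube`** (F300 §2 with the EL reaction).
HONEST FRAMING (page 1): elementary lattice ∕ Banach-algebra analysis of OUR objects; `ρ`, `j`, `r` HYPOTHESES; no minimiser constructed here; nothing of Bałaban's
asserted; NE7 NOT PROVED; spine 0∕9; finite T⁴ rung (B)+1 — NOT infinite volume, NOT mass gap, NOT `BetaPertH`, NOT Clay.  Continuum YM on T⁴ ⇐ BetaPertH ∧ nine spine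
estimates (0/9 proved); BetaPertH ⇐ (D1) ∧ (D4) ∧ CAP+tail; G-an2-4 gates asym, D1 and NE2/3/4.  No `sorry`; axioms ⊆ {propext, Classical.choice, Quot.sound}.
-/

set_option autoImplicit false

open scoped BigOperators Matrix Matrix.Norms.L2Operator
open NormedSpace Finset

namespace Summit.QuantumFields.BalabanUV.T4Continuum.NE7CubeGradientLandauEL

open Literature.MathematicalPhysics.QuantumFieldTheory.Balaban1983to89
open B7Prop1Explicit B7Prop2Explicit
open B7Eq78Linearization (conjR conjR_apply conjR_sub conjR_one)
open B7Prop1Local (AgreeOn InBox)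
open B8Ineq130 (hol_plaqWord_congr)
open B8Ineq132 (covDiv plaqF norm_covDiv_gaugeAct)
open T4AveragingDeficitWall (vary SmallField)
open BlockAveragePushDirSplit (flat)
open AveragingDeficitTransport (mem_U1_of_unitary)
open NE3EnergyShapes (IsUnitarySite)
open NE3AxialGaugeLadder (smallField_gaugeAct)
open NE7GradientCurrency (vary_flat_one_apply)
open NE7GradientCurrencyCovariant (norm_expUnit_sub_one_le')
open NE7GradientCurrencyLandauEL (norm_sinhRem_sub_sinhRem_le)
open NE7LocalGradientBootstrap (weighted_bootstrap norm_fdiff_le_of_plaqDiv_local)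
open NE7CubeGradientOfLandauSup (norm_plaqDivFlat_le_covDiv_local)

noncomputable section

variable {d : ℕ} {n : Type*} [Fintype n] [DecidableEq n] [Nonempty n]

/-! ## §1 The two reaction gradients, locally -/

/-- Bookkeeping: `‖a − b‖ ≤ c` and `‖b‖ ≤ P` give `‖a‖ ≤ P + c`. [folklore] -/
theorem norm_sub_le_norm_add_of_sub {E : Type*} [SeminormedAddCommGroup E] {a b : E} {c P : ℝ} (h1 : ‖a - b‖ ≤ c) (h2 : ‖b‖ ≤ P) : ‖a‖ ≤ P + c := by
  have := norm_le_norm_add_norm_sub' a b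
  linarith [norm_sub_rev a b]

/-- **THE TWO REACTION GRADIENTS DIFFER BY AN ABSORBABLE TERM, LOCALLY** ((158b) `norm_dDiv_sub_dDiv_sinh_le` with hypotheses on the stencil: `‖A‖ ≤ ρ` and the a
priori gradient bound `G` at the sites within sup-distance `1` of `x`): the forward differences (direction `ν`, at `x`) of `div A` and of `div S`, `S = (e^{A} − e^{−A})∕2`, differ
by at most `2(d+1)(e^ρ − 1)·G`. [folklore] -/
theorem norm_dDiv_sub_dDiv_sinh_le_local (A : Site (d + 1) → Fin (d + 1) → Matrix n n ℂ) (x : Site (d + 1)) (ν : Fin (d + 1)) {ρ G : ℝ}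
    (hA : ∀ (w : Site (d + 1)), (∀ i, |w i - x i| ≤ 1) → ∀ (κ : Fin (d + 1)), ‖A w κ‖ ≤ ρ)
    (hG : ∀ (w : Site (d + 1)), (∀ i, |w i - x i| ≤ 1) → ∀ (κ τ : Fin (d + 1)), ‖A (w + e τ) κ - A w κ‖ ≤ G) :
    ‖(∑ μ, (A (x + e ν) μ - A (x + e ν - e μ) μ) - ∑ μ, (A x μ - A (x - e μ) μ))
      - (∑ μ, (((2 : ℂ)⁻¹ • (exp (A (x + e ν) μ) - exp (-A (x + e ν) μ)))
                - ((2 : ℂ)⁻¹ • (exp (A (x + e ν - e μ) μ) - exp (-A (x + e ν - e μ) μ))))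
          - ∑ μ, (((2 : ℂ)⁻¹ • (exp (A x μ) - exp (-A x μ))) - ((2 : ℂ)⁻¹ • (exp (A (x - e μ) μ) - exp (-A (x - e μ) μ)))))‖
      ≤ 2 * ((d + 1 : ℕ) : ℝ) * (Real.exp ρ - 1) * G := by
  have e1 : ∀ (a : Fin (d + 1)) (i : Fin (d + 1)), |(e a : Site (d + 1)) i| ≤ 1 := fun a i => by rw [e_apply]; split_ifs <;> simp
  have nx : ∀ i, |x i - x i| ≤ 1 := fun i => by simp
  have nxm : ∀ (a : Fin (d + 1)) (i : Fin (d + 1)), |(x - e a) i - x i| ≤ 1 := fun a i => by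
    rw [show (x - e a) i - x i = -(e a : Site (d + 1)) i by simp, abs_neg]; exact e1 a i
  have nxp : ∀ (a : Fin (d + 1)) (i : Fin (d + 1)), |(x + e a) i - x i| ≤ 1 := fun a i => by
    rw [show (x + e a) i - x i = (e a : Site (d + 1)) i by simp]; exact e1 a i
  have nxmp : ∀ (a b : Fin (d + 1)) (i : Fin (d + 1)), |(x - e a + e b) i - x i| ≤ 1 := fun a b i => by
    rw [show (x - e a + e b) i - x i = (e b : Site (d + 1)) i - (e a : Site (d + 1)) i by simp; ring, e_apply, e_apply]
    split_ifs <;> simp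
  set T : Site (d + 1) → Fin (d + 1) → (Matrix n n ℂ) := fun y μ => (2 : ℂ)⁻¹ • (exp (A y μ) - exp (-A y μ)) - A y μ with hT
  have hid : (∑ μ, (A (x + e ν) μ - A (x + e ν - e μ) μ) - ∑ μ, (A x μ - A (x - e μ) μ))
      - (∑ μ, (((2 : ℂ)⁻¹ • (exp (A (x + e ν) μ) - exp (-A (x + e ν) μ)))
                - ((2 : ℂ)⁻¹ • (exp (A (x + e ν - e μ) μ) - exp (-A (x + e ν - e μ) μ))))
          - ∑ μ, (((2 : ℂ)⁻¹ • (exp (A x μ) - exp (-A x μ))) - ((2 : ℂ)⁻¹ • (exp (A (x - e μ) μ) - exp (-A (x - e μ) μ)))))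
      = -(∑ μ, ((T (x + e ν) μ - T x μ) - (T (x + e ν - e μ) μ - T (x - e μ) μ))) := by
    simp only [hT, Finset.sum_sub_distrib]
    abel
  rw [hid, norm_neg]
  have hLip1 : ∀ μ : Fin (d + 1), ‖T (x + e ν) μ - T x μ‖ ≤ (Real.exp ρ - 1) * G := by
    intro μ
    have h := norm_sinhRem_sub_sinhRem_le (hA (x + e ν) (nxp ν) μ) (hA x nx μ)
    simp only [hT]
    refine h.trans (mul_le_mul_of_nonneg_left (hG x nx μ ν) ?_)
    have hρ0 : 0 ≤ ρ := (norm_nonneg _).trans (hA x nx μ)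
    have := Real.add_one_le_exp ρ
    linarith
  have hLip2 : ∀ μ : Fin (d + 1), ‖T (x + e ν - e μ) μ - T (x - e μ) μ‖ ≤ (Real.exp ρ - 1) * G := by
    intro μ
    have hxx : x + e ν - e μ = x - e μ + e ν := by abel
    rw [hxx]
    have h := norm_sinhRem_sub_sinhRem_le (hA (x - e μ + e ν) (nxmp μ ν) μ) (hA (x - e μ) (nxm μ) μ)
    simp only [hT]
    refine h.trans (mul_le_mul_of_nonneg_left (hG (x - e μ) (nxm μ) μ ν) ?_)
    have hρ0 : 0 ≤ ρ := (norm_nonneg _).trans (hA x nx μ)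
    have := Real.add_one_le_exp ρ
    linarith
  refine (norm_sum_le _ _).trans ?_
  calc ∑ μ, ‖(T (x + e ν) μ - T x μ) - (T (x + e ν - e μ) μ - T (x - e μ) μ)‖
      ≤ ∑ _μ : Fin (d + 1), ((Real.exp ρ - 1) * G + (Real.exp ρ - 1) * G) := Finset.sum_le_sum fun μ _ =>
          (norm_sub_le _ _).trans (add_le_add (hLip1 μ) (hLip2 μ))
    _ = 2 * ((d + 1 : ℕ) : ℝ) * (Real.exp ρ - 1) * G := by
        rw [Finset.sum_const, Finset.card_univ, Fintype.card_fin, nsmul_eq_mul]; push_cast; ring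

/-! ## §2 The local estimate and the cube bootstrap with the EL reaction -/

set_option maxHeartbeats 800000 in
/-- **THE LOCAL GRADIENT ESTIMATE WITH THE REACTION IN EULER–LAGRANGE FORM**: F299's `norm_fdiff_le_of_plaqDiv_local` with the divergence-gradient hypothesis on
`S = (e^{A} − e^{−A})∕2` instead of `A`; the difference `2(d+1)(e^ρ − 1)·G` (§1) joins the a priori term:
`‖A(x+e_τ)_ν − A(x)_ν‖ ≤ 2·((d+1)ρ∕R + R·(J + (4(d+1)(e^{4ρ} − 1) + 2(d+1)(e^{ρ} − 1))·G + P))`. [folklore] -/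
theorem norm_fdiff_le_of_plaqDiv_local_EL (A : Site (d + 1) → Fin (d + 1) → Matrix n n ℂ) (x : Site (d + 1)) {R : ℕ} (hR : 1 ≤ R) {ρ G J P : ℝ}
    (hA : ∀ (y : Site (d + 1)) (κ : Fin (d + 1)), (∀ i, |y i - x i| ≤ (R : ℤ) + 1) → ‖A y κ‖ ≤ ρ)
    (hG : ∀ (y : Site (d + 1)) (κ τ : Fin (d + 1)), (∀ i, |y i - x i| ≤ (R : ℤ) + 1) → ‖A (y + e τ) κ - A y κ‖ ≤ G)
    (hJ : ∀ (y : Site (d + 1)) (ν : Fin (d + 1)), (∀ i, |y i - x i| ≤ (R : ℤ)) →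
      ‖∑ μ, ((((hol (vary (flat (d := d + 1) (n := n)) A 1) y (plaqWord μ ν) : (Matrix n n ℂ)ˣ) : Matrix n n ℂ) - 1)
              - (((hol (vary (flat (d := d + 1) (n := n)) A 1) (y - e μ) (plaqWord μ ν) : (Matrix n n ℂ)ˣ) : Matrix n n ℂ) - 1))‖ ≤ J)
    (hP : ∀ (y : Site (d + 1)) (ν : Fin (d + 1)), (∀ i, |y i - x i| ≤ (R : ℤ)) →
      ‖(∑ μ, (((2 : ℂ)⁻¹ • (exp (A (y + e ν) μ) - exp (-A (y + e ν) μ)))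
                - ((2 : ℂ)⁻¹ • (exp (A (y + e ν - e μ) μ) - exp (-A (y + e ν - e μ) μ))))
          - ∑ μ, (((2 : ℂ)⁻¹ • (exp (A y μ) - exp (-A y μ))) - ((2 : ℂ)⁻¹ • (exp (A (y - e μ) μ) - exp (-A (y - e μ) μ)))))‖ ≤ P)
    (ν τ : Fin (d + 1)) :
    ‖A (x + e τ) ν - A x ν‖ ≤ 2 * ((((d + 1 : ℕ) : ℝ)) * ρ / R
      + R * ((J + 4 * ((d + 1 : ℕ) : ℝ) * (Real.exp (4 * ρ) - 1) * G) + (P + 2 * ((d + 1 : ℕ) : ℝ) * (Real.exp ρ - 1) * G))) := by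
  refine norm_fdiff_le_of_plaqDiv_local (n := n) A x hR hA hG hJ (fun y ν' hy => ?_) ν τ
  have h1 := norm_dDiv_sub_dDiv_sinh_le_local A y ν' (ρ := ρ) (G := G)
    (fun w hw κ => hA w κ fun i => by
      have : |w i - x i| ≤ |w i - y i| + |y i - x i| := by
        rw [show w i - x i = (w i - y i) + (y i - x i) by ring]; exact abs_add_le _ _
      linarith [hw i, hy i])
    (fun w hw κ τ' => hG w κ τ' fun i => by
      have : |w i - x i| ≤ |w i - y i| + |y i - x i| := by
        rw [show w i - x i = (w i - y i) + (y i - x i) by ring]; exact abs_add_le _ _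
      linarith [hw i, hy i])
  have h2 := hP y ν' hy
  have h3 := norm_sub_le_norm_add_of_sub h1 h2
  exact h3



set_option maxHeartbeats 800000 in
/-- **THE GRADIENT LETTER ON A CUBE, REACTION IN EULER–LAGRANGE FORM, WITHOUT LOGARITHM.**  For `A : ℤ^{d+1} → (Fin (d+1) → Matrix n n ℂ)` and a sup-cube of radius `R₀ ≥ 1` about `z` on which `‖A‖ ≤ ρ`, the
plaquette divergence of `W = e^{A}` is `≤ J` and the divergence gradient of `S = (e^{A} − e^{−A})∕2` is `≤ P`, under `32(d+1)R₀(e^{4ρ} − 1) + 16(d+1)R₀(e^{ρ} − 1) ≤ 1`: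
at every `y` of depth `D₀ ≥ 1` (`|y − z|_∞ + D₀ ≤ R₀`), `‖A(y + e_τ, κ) − A(y, κ)‖ ≤ (6ρ + 14(d+1)ρ + 2R₀²(J + P))∕D₀` (§2 over §3). [folklore] -/
theorem norm_fdiff_le_of_plaqDiv_cube_EL (A : Site (d + 1) → Fin (d + 1) → Matrix n n ℂ) (z : Site (d + 1)) (R₀ : ℕ) (hR₀ : 1 ≤ R₀) {ρ J P : ℝ}
    (hρ : 0 ≤ ρ) (hJ0 : 0 ≤ J) (hP0 : 0 ≤ P)
    (hA : ∀ (y : Site (d + 1)) (κ : Fin (d + 1)), (∀ i, |y i - z i| ≤ (R₀ : ℤ)) → ‖A y κ‖ ≤ ρ)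
    (hJ : ∀ (y : Site (d + 1)) (ν : Fin (d + 1)), (∀ i, |y i - z i| ≤ (R₀ : ℤ)) →
      ‖∑ μ, ((((hol (vary (flat (d := d + 1) (n := n)) A 1) y (plaqWord μ ν) : (Matrix n n ℂ)ˣ) : Matrix n n ℂ) - 1)
              - (((hol (vary (flat (d := d + 1) (n := n)) A 1) (y - e μ) (plaqWord μ ν) : (Matrix n n ℂ)ˣ) : Matrix n n ℂ) - 1))‖ ≤ J)
    (hP : ∀ (y : Site (d + 1)) (ν : Fin (d + 1)), (∀ i, |y i - z i| ≤ (R₀ : ℤ)) →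
      ‖(∑ μ, (((2 : ℂ)⁻¹ • (exp (A (y + e ν) μ) - exp (-A (y + e ν) μ)))
                - ((2 : ℂ)⁻¹ • (exp (A (y + e ν - e μ) μ) - exp (-A (y + e ν - e μ) μ))))
          - ∑ μ, (((2 : ℂ)⁻¹ • (exp (A y μ) - exp (-A y μ))) - ((2 : ℂ)⁻¹ • (exp (A (y - e μ) μ) - exp (-A (y - e μ) μ)))))‖ ≤ P)
    (hs : 32 * ((d + 1 : ℕ) : ℝ) * R₀ * (Real.exp (4 * ρ) - 1) + 16 * ((d + 1 : ℕ) : ℝ) * R₀ * (Real.exp ρ - 1) ≤ 1)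
    (y : Site (d + 1)) (D₀ : ℕ) (hD₀ : 1 ≤ D₀) (hy : ∀ i, |y i - z i| + (D₀ : ℤ) ≤ (R₀ : ℤ)) (κ τ : Fin (d + 1)) :
    ‖A (y + e τ) κ - A y κ‖ ≤ (6 * ρ + 14 * ((d + 1 : ℕ) : ℝ) * ρ + 2 * (R₀ : ℝ) ^ 2 * (J + P)) / D₀ := by
  have hexp : 0 ≤ Real.exp (4 * ρ) - 1 := by linarith [Real.one_le_exp (by positivity : 0 ≤ 4 * ρ)]
  have hexp1 : 0 ≤ Real.exp ρ - 1 := by linarith [Real.one_le_exp hρ]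
  have e1 : ∀ (a : Fin (d + 1)) (i : Fin (d + 1)), |(e a : Site (d + 1)) i| ≤ 1 := fun a i => by rw [e_apply]; split_ifs <;> simp
  have h := weighted_bootstrap (fun w κ' τ' => ‖A (w + e τ') κ' - A w κ'‖) z R₀ hR₀ (g₀ := 2 * ρ) (a := 2 * ((d + 1 : ℕ) : ℝ) * ρ)
    (b := 2 * (J + P)) (θ := 2 * (4 * ((d + 1 : ℕ) : ℝ) * (Real.exp (4 * ρ) - 1) + 2 * ((d + 1 : ℕ) : ℝ) * (Real.exp ρ - 1)))
    (by positivity) (by positivity) (by positivity)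
    (fun _ _ _ => norm_nonneg _) ?_ ?_ ?_ y D₀ hD₀ hy κ τ
  · refine h.trans (le_of_eq ?_)
    ring
  · -- the trivial bound `2ρ` at depth ≥ 1
    intro w κ' τ' hw
    have h1 : ‖A w κ'‖ ≤ ρ := hA w κ' fun i => (hw i).trans (by linarith)
    have h2 : ‖A (w + e τ') κ'‖ ≤ ρ := hA _ κ' fun i => by
      have : |(w + e τ') i - z i| ≤ |(e τ' : Site (d + 1)) i| + |w i - z i| := by
        rw [show (w + e τ') i - z i = (e τ' : Site (d + 1)) i + (w i - z i) by simp; ring]; exact abs_add_le _ _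
      linarith [e1 τ' i, hw i]
    calc ‖A (w + e τ') κ' - A w κ'‖ ≤ ‖A (w + e τ') κ'‖ + ‖A w κ'‖ := norm_sub_le _ _
      _ ≤ 2 * ρ := by linarith
  · -- the local estimate: §3 at radius `R` about `w`
    intro w R hR hw G hG κ' τ'
    have hin : ∀ (w' : Site (d + 1)), (∀ i, |w' i - w i| ≤ (R : ℤ) + 1) → ∀ i, |w' i - z i| ≤ (R₀ : ℤ) := fun w' hw' i => by
      have h1 : |w' i - z i| ≤ |w' i - w i| + |w i - z i| := by
        rw [show w' i - z i = (w' i - w i) + (w i - z i) by ring]; exact abs_add_le _ _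
      have h2 := hw i
      push_cast at h2
      linarith [hw' i]
    have hin' : ∀ (w' : Site (d + 1)), (∀ i, |w' i - w i| ≤ (R : ℤ)) → ∀ i, |w' i - z i| ≤ (R₀ : ℤ) :=
      fun w' hw' => hin w' fun i => (hw' i).trans (by linarith)
    have hl := norm_fdiff_le_of_plaqDiv_local_EL (n := n) A w hR (ρ := ρ) (G := G) (J := J) (P := P)
      (fun w' κ'' hw' => hA w' κ'' (hin w' hw')) (fun w' κ'' τ'' hw' => hG w' hw' κ'' τ'') (fun w' ν hw' => hJ w' ν (hin' w' hw'))
      (fun w' ν hw' => hP w' ν (hin' w' hw')) κ' τ'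
    refine hl.trans (le_of_eq ?_)
    field_simp
    ring
  · -- absorption
    nlinarith


/-! ## §3 The gradient letter on a cube from the sup letter, the covariant current and the Euler–Lagrange reaction -/

set_option maxHeartbeats 800000 in
/-- **THE GRADIENT LETTER OF A CUBE CHART FROM ITS SUP LETTER, THE COVARIANT CURRENT AND THE EULER–LAGRANGE REACTION — LOCALLY, NO LOGARITHM.**  Let `U` be a configuration on
`ℤ^{d+1}` with `SmallField U ε`, `u₀` a unitary site gauge and `A` a bond field with `U^{u₀}(y, κ) = e^{A(y,κ)}` and `‖A(y, κ)‖ ≤ ρ` for `|y − z|_∞ ≤ R₀` (`R₀ ≥ 3`),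
covariant current `‖covDiv 1 U ν y‖ ≤ j` ([Balaban1985RegularSpaces] (1.2), `η = 1`) and divergence-gradient of `S = sinh A = (e^{A} − e^{−A})∕2` (the Euler–Lagrange form of the
lattice Landau condition of a trace-link minimiser, (161b)) `‖div S(y + e_ν) − div S(y)‖ ≤ r` for `|y − z|_∞ ≤ R₀ − 2`, and `32(d+1)(R₀ − 2)(e^{4ρ} − 1) + 16(d+1)(R₀ − 2)(e^{ρ} − 1) ≤ 1`.
Then for every `y` with `|y − z|_∞ + D₀ + 2 ≤ R₀` (`D₀ ≥ 1`): `‖A(y + e_τ, κ) − A(y, κ)‖ ≤ (6ρ + 14(d+1)ρ + 2(R₀ − 2)²·(j + (d+1)·ε·((e^{2ρ} − 1) + 2ε(2 + ε)) + r))∕D₀`.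
[folklore] -/
theorem norm_fdiff_le_of_landauEL_cube {U : Site (d + 1) → Fin (d + 1) → (Matrix n n ℂ)ˣ} {ε : ℝ} (hε0 : 0 ≤ ε) (hUε : SmallField U ε)
    {u₀ : Site (d + 1) → (Matrix n n ℂ)ˣ} (hu₀ : IsUnitarySite u₀) {A : Site (d + 1) → Fin (d + 1) → Matrix n n ℂ}
    (z : Site (d + 1)) (R₀ : ℕ) (hR₀ : 3 ≤ R₀) {ρ j r : ℝ} (hρ : 0 ≤ ρ) (hj : 0 ≤ j) (hr : 0 ≤ r)
    (hUA : ∀ (y : Site (d + 1)) (κ : Fin (d + 1)), (∀ i, |y i - z i| ≤ (R₀ : ℤ)) → gaugeAct u₀ U y κ = expUnit (A y κ))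
    (hA : ∀ (y : Site (d + 1)) (κ : Fin (d + 1)), (∀ i, |y i - z i| ≤ (R₀ : ℤ)) → ‖A y κ‖ ≤ ρ)
    (hcov : ∀ (y : Site (d + 1)) (ν : Fin (d + 1)), (∀ i, |y i - z i| ≤ (R₀ : ℤ) - 2) → ‖covDiv 1 U ν y‖ ≤ j)
    (hP : ∀ (y : Site (d + 1)) (ν : Fin (d + 1)), (∀ i, |y i - z i| ≤ (R₀ : ℤ) - 2) →
      ‖(∑ μ, (((2 : ℂ)⁻¹ • (exp (A (y + e ν) μ) - exp (-A (y + e ν) μ)))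
                - ((2 : ℂ)⁻¹ • (exp (A (y + e ν - e μ) μ) - exp (-A (y + e ν - e μ) μ))))
          - ∑ μ, (((2 : ℂ)⁻¹ • (exp (A y μ) - exp (-A y μ))) - ((2 : ℂ)⁻¹ • (exp (A (y - e μ) μ) - exp (-A (y - e μ) μ)))))‖ ≤ r)
    (hs : 32 * ((d + 1 : ℕ) : ℝ) * ((R₀ - 2 : ℕ) : ℝ) * (Real.exp (4 * ρ) - 1) + 16 * ((d + 1 : ℕ) : ℝ) * ((R₀ - 2 : ℕ) : ℝ) * (Real.exp ρ - 1) ≤ 1)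
    (y : Site (d + 1)) (D₀ : ℕ) (hD₀ : 1 ≤ D₀) (hy : ∀ i, |y i - z i| + (D₀ : ℤ) + 2 ≤ (R₀ : ℤ)) (κ τ : Fin (d + 1)) :
    ‖A (y + e τ) κ - A y κ‖
      ≤ (6 * ρ + 14 * ((d + 1 : ℕ) : ℝ) * ρ
          + 2 * ((R₀ - 2 : ℕ) : ℝ) ^ 2 * ((j + ((d + 1 : ℕ) : ℝ) * (ε * ((Real.exp (2 * ρ) - 1) + 2 * ε * (2 + ε)))) + r)) / D₀ := by
  -- the gauged configuration and its agreement with `e^{A}` on the cube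
  set W : Site (d + 1) → Fin (d + 1) → (Matrix n n ℂ)ˣ := gaugeAct u₀ U with hW
  have hWε : SmallField W ε := smallField_gaugeAct hu₀ hUε
  have hagree : AgreeOn (z - fun _ => (R₀ : ℤ)) (z + fun _ => (R₀ : ℤ)) (vary (flat (d := d + 1) (n := n)) A 1) W := by
    intro x κ' hx _
    have hx' : ∀ i, |x i - z i| ≤ (R₀ : ℤ) := fun i => by
      have h := hx i; simp only [Pi.sub_apply, Pi.add_apply] at h; rw [abs_le]; constructor <;> linarith [h.1, h.2]
    rw [vary_flat_one_apply]
    exact (hUA x κ' hx').symm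
  have hbox : ∀ (x : Site (d + 1)), (∀ i, |x i - z i| ≤ (R₀ : ℤ)) → InBox (z - fun _ => (R₀ : ℤ)) (z + fun _ => (R₀ : ℤ)) x := fun x hx i => by
    have h := abs_le.mp (hx i); simp only [Pi.sub_apply, Pi.add_apply]; constructor <;> linarith [h.1, h.2]
  have e1 : ∀ (a : Fin (d + 1)) (i : Fin (d + 1)), |(e a : Site (d + 1)) i| ≤ 1 := fun a i => by rw [e_apply]; split_ifs <;> simp
  -- points near an interior site stay in the cube
  have near1 : ∀ (x : Site (d + 1)) (a : Fin (d + 1)) (c : ℤ), (∀ i, |x i - z i| ≤ c) → ∀ i, |(x + e a) i - z i| ≤ c + 1 := fun x a c hx i => by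
    have : |(x + e a) i - z i| ≤ |(e a : Site (d + 1)) i| + |x i - z i| := by
      rw [show (x + e a) i - z i = (e a : Site (d + 1)) i + (x i - z i) by simp; ring]; exact abs_add_le _ _
    linarith [e1 a i, hx i]
  have near1m : ∀ (x : Site (d + 1)) (a : Fin (d + 1)) (c : ℤ), (∀ i, |x i - z i| ≤ c) → ∀ i, |(x - e a) i - z i| ≤ c + 1 := fun x a c hx i => by
    have : |(x - e a) i - z i| ≤ |(e a : Site (d + 1)) i| + |x i - z i| := by
      rw [show (x - e a) i - z i = -(e a : Site (d + 1)) i + (x i - z i) by simp; ring]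
      exact (abs_add_le _ _).trans (by rw [abs_neg])
    linarith [e1 a i, hx i]
  -- plaquette holonomies of `e^{A}` and of `W` agree at sites of depth ≥ 2
  have hplaq : ∀ (x : Site (d + 1)) (a b : Fin (d + 1)), (∀ i, |x i - z i| ≤ (R₀ : ℤ) - 2) →
      hol (vary (flat (d := d + 1) (n := n)) A 1) x (plaqWord a b) = hol W x (plaqWord a b) := fun x a b hx =>
    hol_plaqWord_congr hagree x a b (hbox x fun i => (hx i).trans (by linarith))
      (hbox _ fun i => by linarith [near1 (x + e a) b _ (near1 x a _ hx) i])
  have e3 : ∀ (μ a b : Fin (d + 1)) (i : Fin (d + 1)), |(-(e μ : Site (d + 1)) i + (e a : Site (d + 1)) i) + (e b : Site (d + 1)) i| ≤ 2 := by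
    intro μ a b i
    rw [e_apply, e_apply, e_apply]; split_ifs <;> norm_num
  have hplaqm : ∀ (x : Site (d + 1)) (μ a b : Fin (d + 1)), (∀ i, |x i - z i| ≤ (R₀ : ℤ) - 2) →
      hol (vary (flat (d := d + 1) (n := n)) A 1) (x - e μ) (plaqWord a b) = hol W (x - e μ) (plaqWord a b) := fun x μ a b hx =>
    hol_plaqWord_congr hagree (x - e μ) a b (hbox _ fun i => by linarith [near1m x μ _ hx i])
      (hbox _ fun i => by
        have h1 : |(x - e μ + e a + e b) i - z i| ≤ |x i - z i| + |(-(e μ : Site (d + 1)) i + (e a : Site (d + 1)) i) + (e b : Site (d + 1)) i| := by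
          rw [show (x - e μ + e a + e b) i - z i = (x i - z i) + ((-(e μ : Site (d + 1)) i + (e a : Site (d + 1)) i) + (e b : Site (d + 1)) i) by
            simp only [Pi.add_apply, Pi.sub_apply]; ring]
          exact abs_add_le _ _
        linarith [hx i, e3 μ a b i])
  -- the plaquette-divergence datum `J` on the cube of radius `R₀ − 2`
  have hR2 : ((R₀ - 2 : ℕ) : ℤ) = (R₀ : ℤ) - 2 := by push_cast [Nat.cast_sub (by omega : 2 ≤ R₀)]; ring
  have hJ : ∀ (x : Site (d + 1)) (ν : Fin (d + 1)), (∀ i, |x i - z i| ≤ ((R₀ - 2 : ℕ) : ℤ)) →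
      ‖∑ μ, ((((hol (vary (flat (d := d + 1) (n := n)) A 1) x (plaqWord μ ν) : (Matrix n n ℂ)ˣ) : (Matrix n n ℂ)) - 1)
              - (((hol (vary (flat (d := d + 1) (n := n)) A 1) (x - e μ) (plaqWord μ ν) : (Matrix n n ℂ)ˣ) : (Matrix n n ℂ)) - 1))‖
        ≤ j + ((d + 1 : ℕ) : ℝ) * (ε * ((Real.exp (2 * ρ) - 1) + 2 * ε * (2 + ε))) := by
    intro x ν hx
    rw [hR2] at hx
    have hsum : ∑ μ, ((((hol (vary (flat (d := d + 1) (n := n)) A 1) x (plaqWord μ ν) : (Matrix n n ℂ)ˣ) : (Matrix n n ℂ)) - 1)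
              - (((hol (vary (flat (d := d + 1) (n := n)) A 1) (x - e μ) (plaqWord μ ν) : (Matrix n n ℂ)ˣ) : (Matrix n n ℂ)) - 1))
        = ∑ μ, ((((hol W x (plaqWord μ ν) : (Matrix n n ℂ)ˣ) : (Matrix n n ℂ)) - 1) - (((hol W (x - e μ) (plaqWord μ ν) : (Matrix n n ℂ)ˣ) : (Matrix n n ℂ)) - 1)) :=
      Finset.sum_congr rfl fun μ _ => by rw [hplaq x μ ν hx, hplaqm x μ μ ν hx]
    rw [hsum]
    -- bond radius on the stencil from the sup letter
    have hWb : ∀ μ : Fin (d + 1), ‖((W (x - e μ) μ : (Matrix n n ℂ)ˣ) : (Matrix n n ℂ)) - 1‖ ≤ Real.exp ρ - 1 ∧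
        ‖(((W (x - e μ) μ)⁻¹ : (Matrix n n ℂ)ˣ) : (Matrix n n ℂ)) - 1‖ ≤ Real.exp ρ - 1 := fun μ => by
      have hxm : ∀ i, |(x - e μ) i - z i| ≤ (R₀ : ℤ) := fun i => by linarith [near1m x μ _ hx i]
      have hWx : W (x - e μ) μ = expUnit (A (x - e μ) μ) := by rw [hW]; exact hUA _ μ hxm
      rw [hWx]; exact norm_expUnit_sub_one_le' (hA _ μ hxm)
    have hb0 : 0 ≤ Real.exp ρ - 1 := by linarith [Real.add_one_le_exp ρ]
    have h := norm_plaqDivFlat_le_covDiv_local W hε0 hb0 x hWb hWε ν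
    have hcovW : ‖covDiv 1 W ν x‖ = ‖covDiv 1 U ν x‖ := by
      rw [hW]; exact norm_covDiv_gaugeAct 1 (fun w => mem_U1_of_unitary (hu₀ w)) U ν x
    rw [hcovW] at h
    refine h.trans ?_
    have he : Real.exp ρ - 1 + 2 = Real.exp ρ + 1 := by ring
    have hexp2 : ε * (Real.exp ρ - 1) * (2 + (Real.exp ρ - 1)) + 2 * ε * ε * (2 + ε) = ε * ((Real.exp (2 * ρ) - 1) + 2 * ε * (2 + ε)) := by
      rw [show (2 : ℝ) * ρ = ρ + ρ by ring, Real.exp_add]; ring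
    have hc := hcov x ν hx
    rw [hexp2]
    push_cast
    linarith
  -- F299 on the cube of radius `R₀ − 2`
  have hR1 : 1 ≤ R₀ - 2 := by omega
  have hJ0 : 0 ≤ j + ((d + 1 : ℕ) : ℝ) * (ε * ((Real.exp (2 * ρ) - 1) + 2 * ε * (2 + ε))) := by
    have : 0 ≤ Real.exp (2 * ρ) - 1 := by linarith [Real.add_one_le_exp (2 * ρ)]
    positivity
  have hy' : ∀ i, |y i - z i| + (D₀ : ℤ) ≤ ((R₀ - 2 : ℕ) : ℤ) := fun i => by rw [hR2]; linarith [hy i]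
  exact norm_fdiff_le_of_plaqDiv_cube_EL (n := n) A z (R₀ - 2) hR1 hρ hJ0 hr (fun x κ' hx => hA x κ' fun i => by rw [hR2] at hx; linarith [hx i])
    hJ (fun x ν hx => hP x ν fun i => by rw [hR2] at hx; exact hx i) hs y D₀ hD₀ hy' κ τ

end

end Summit.QuantumFields.BalabanUV.T4Continuum.NE7CubeGradientLandauEL
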